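import Literature.Analysis.FluidPDE.OseenDuhamelRadialDecay
import Literature.Analysis.FluidPDE.OseenSlabPhysical
import Literature.Analysis.FluidPDE.ClassicalSupStabilityForced
import HarnessLib

/-!
# Bounded solutions of the Oseen integral equation with data vanishing at infinity vanish at
# spatial infinity, uniformly on the time slab

Analysis/FluidPDE proof file (theorems only; no definitions, no named facts, no `sorry`). The
qualitative decay statement in the proof of Koch–Nadirashvili–Seregin–Šverák 2009, Thm. 6.1 (last
paragraph, "(6.2) is preserved"), for the NONLINEAR integral equation on `ℝ³` at unit viscosity:

Let `v` be a field on `[0, T] × ℝ³` with continuous slices, jointly measurable on the open slab,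
bounded by `M`, satisfying the Oseen integral identity up to a remainder,
`v(t) = e^{tΔ} v(0) − B¹_0(v, v)(t) + Φ(t)` a.e. for `t ∈ (0, T]`, whose datum `v(0)` and remainder
`Φ` vanish at spatial infinity (the remainder uniformly in `t`). Then `v` vanishes at spatial
infinity UNIFORMLY in `t ∈ [0, T]`:
`∀ ε > 0, ∃ A, ∀ t ∈ [0, T], ‖x‖ ≥ A → ‖v(t, x)‖ ≤ ε` (`exists_forall_norm_le_of_oseenMild_remainder`).
Corollary (`IsClassicalNSSolutionOn.exists_forall_norm_le_of_datum_decay`): a bounded classical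
finite-energy solution of the UNFORCED Navier–Stokes system on `[0, T] × ℝ³` (`ν = 1`) whose datum
vanishes at infinity (e.g. has compact support) vanishes at spatial infinity uniformly on `[0, T]`.

Mechanism (a self-contained bootstrap, no Picard iteration and no restart): write
`Θ(R) := sup_{t ≤ T, ‖y‖ > R} e^{−λt} ‖v(t, y)‖` with `λ = 36 C₀² M²` (`C₀ = oseenSliceConst ℝ³`).
Split the right factor `v = v·1_{‖y‖ ≤ R₀} + v·1_{‖y‖ > R₀}` in `B(v, v)`: the near piece is small far
away by the kernel decay `|K| ≲ (τ + |z|²)^{-2}` (the tree's `norm_oseenDuhamel_near_le_of_norm`), the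
far piece is at most `C₀ M Θ(R₀) ∫₀ᵗ (t−τ)^{-1/2} e^{λτ} dτ ≤ ½ e^{λt} Θ(R₀)` by the slice estimate
against the exponential weight (`setIntegral_visc_abelKernel_mul_exp_le`), and the heat term is small
far away uniformly in bounded time (`exists_forall_norm_heatFlow_le_of_norm`). Hence
`Θ(A) ≤ o(1) + ½ Θ(A₀)` for `A ≫ A₀`, and by induction `Θ(A_n) ≤ M 2^{-n} + θ`; the factor
`e^{λT}` lost at the end is harmless for a qualitative statement. LABEL: Literature port (a-priori,
qualitative). WHAT THIS IS NOT: no rate of decay is asserted, and nothing about regularity or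
blow-up — the field is assumed bounded on the slab.

Consumer: the superposition door of the cell `ns-blowup` (route `PalasekTowerBreakdown`, crux
`EpisodeBase`, stmt-NavierStokesRegularity-19179): the cross Duhamel term of two free runs placed far
apart is uniformly small because each run is uniformly small far from its own datum.

## Mathlib / tree search

Tree: `norm_oseenDuhamel_near_le_of_norm`, `exists_norm_oseenKernel_le`,
`integrable_one_add_norm_sq_rpow_neg`, `tendsto_setIntegral_norm_ge_atTop`
(`OseenDuhamelRadialDecay`, `KochTataruKernel`, `KNSSMildDecayHorizontal`);
`exists_forall_norm_heatFlow_le_of_norm`, `heatFlow_of_pos` (`OseenSlabPhysical`, `MildSolution`);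
`norm_oseenDuhamel_le_setIntegral_visc`, `setIntegral_visc_abelKernel_mul_exp_le`
(`ClassicalSupStabilityForced`); `oseenDuhamel_sub_right` (`KatoLocalBoundedPicard`);
`IsClassicalNSSolutionOn.ae_eq_forced_oseenMild`. The tree had the one-slot statements
`exists_forall_norm_oseenDuhamel_le_of_norm_left/right` (decay of `B(p,q)` GIVEN the decay of one
factor) but not the bootstrap for a solution (`lean search 'datum_decay|oseenMild_remainder'`).

## References

* G. Koch, N. Nadirashvili, G. Seregin, V. Šverák, *Liouville theorems for the Navier–Stokes
  equations and applications*, Acta Math. 203 (2009) = arXiv:0709.3599, §3 (3.8) and proof of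
  Thm. 6.1, last paragraph. [KochNadirashviliSereginSverak2009]
* L. Brandolese, *Space-time decay of Navier–Stokes flows invariant under rotations*, Math. Ann. 329
  (2004), §1 (spatial localisation of flows from localised data; background). [folklore pointer]
* P. G. Lemarié-Rieusset, *The Navier–Stokes Problem in the 21st Century* (2016), Thm. 6.1 (6.12)
  with Prop. 6.5 (the integral equation). [LemarieRieusset2016]
-/

noncomputable section

open MeasureTheory Set Function Filter
open _root_.Topology
open scoped ENNReal NNReal

namespace Literature.Analysis.FluidPDE

section Decay

/-- An a.e. bound on a continuous field, asserted on an open set, holds everywhere on that set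
(Lebesgue measure charges nonempty open sets). [folklore] -/
private theorem forall_norm_le_of_ae_norm_le_on
    {f : EuclideanSpace ℝ (Fin 3) → EuclideanSpace ℝ (Fin 3)} (hf : Continuous f)
    {U : Set (EuclideanSpace ℝ (Fin 3))} (hU : IsOpen U) {b : ℝ}
    (h : ∀ᵐ x ∂(volume : Measure (EuclideanSpace ℝ (Fin 3))), x ∈ U → ‖f x‖ ≤ b) :
    ∀ x ∈ U, ‖f x‖ ≤ b := by
  intro x hx
  by_contra hxb
  set V : Set (EuclideanSpace ℝ (Fin 3)) := U ∩ {y | b < ‖f y‖} with hV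
  have hVo : IsOpen V := hU.inter (isOpen_lt continuous_const hf.norm)
  have hV0 : (volume : Measure (EuclideanSpace ℝ (Fin 3))) V = 0 := by
    refine measure_eq_zero_iff_ae_notMem.2 ?_
    filter_upwards [h] with y hy hyV
    exact absurd (hy hyV.1) (not_le.2 hyV.2)
  have hVe : V = ∅ := (hVo.measure_eq_zero_iff volume).1 hV0
  have hxV : x ∈ V := ⟨hx, not_le.1 hxb⟩
  rw [hVe] at hxV
  exact hxV

variable {T M : ℝ} {v Φ : ℝ → EuclideanSpace ℝ (Fin 3) → EuclideanSpace ℝ (Fin 3)}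

/-- **Bounded solutions of the Oseen integral equation with data vanishing at infinity vanish at
spatial infinity, uniformly on the slab.** Let `v` be a field on `[0, T] × ℝ³` (`T > 0`) with
continuous slices, jointly (a.e.-strongly) measurable on the open slab, `‖v‖ ≤ M` (`M > 0`),
satisfying for every `t ∈ (0, T]`, a.e. in `x`, `v(t) = e^{tΔ}v(0) − B¹_0(v,v)(t) + Φ(t)`, where
`v(0)` vanishes at infinity (`∀ η > 0, ∃ R, ‖y‖ ≥ R → ‖v(0,y)‖ ≤ η`) and so does `Φ`, uniformly in
`t ∈ (0, T]`. Then for every `ε > 0` there is `A` with `‖v(t, x)‖ ≤ ε` for all `t ∈ [0, T]` and all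
`‖x‖ ≥ A`. (KNSS 2009, proof of Thm. 6.1, last paragraph, for the nonlinear equation.)
[cite: KochNadirashviliSereginSverak2009, proof of Thm 6.1, last paragraph (arXiv p. 12)] -/
theorem exists_forall_norm_le_of_oseenMild_remainder (hT : 0 < T)
    (hslc : ∀ t ∈ Icc 0 T, Continuous (v t))
    (hmeas : AEStronglyMeasurable (uncurry v)
      ((volume : Measure (ℝ × EuclideanSpace ℝ (Fin 3))).restrict (Ioo 0 T ×ˢ univ)))
    (hM : 0 < M) (hbd : ∀ t ∈ Icc 0 T, ∀ y, ‖v t y‖ ≤ M)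
    (hrep : ∀ t ∈ Ioc 0 T, v t =ᵐ[volume] fun x =>
      UnboundedOperators.heatExtension (v 0) t x - oseenDuhamel 1 0 v v t x + Φ t x)
    (hdec0 : ∀ η : ℝ, 0 < η → ∃ R : ℝ, ∀ y, R ≤ ‖y‖ → ‖v 0 y‖ ≤ η)
    (hdecΦ : ∀ η : ℝ, 0 < η → ∃ R : ℝ, ∀ t ∈ Ioc 0 T, ∀ x, R ≤ ‖x‖ → ‖Φ t x‖ ≤ η)
    {ε : ℝ} (hε : 0 < ε) :
    ∃ A : ℝ, ∀ t ∈ Icc 0 T, ∀ x, A ≤ ‖x‖ → ‖v t x‖ ≤ ε := by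
  -- ### constants
  set C₀ : ℝ := oseenSliceConst (EuclideanSpace ℝ (Fin 3)) with hC₀def
  have hC₀ : 0 < C₀ := oseenSliceConst_pos
  set lam : ℝ := 36 * C₀ ^ 2 * M ^ 2 / 1 with hlam_def
  have hlam : 0 < lam := by positivity
  have hν : (0 : ℝ) < 1 := one_pos
  -- the key algebraic identity behind the choice of `λ`: `3 C₀ M λ^{-1/2} = 1/2`
  have hkey : C₀ * ((1 : ℝ) ^ (-(1 / 2 : ℝ)) * (3 * lam ^ (-(1 / 2 : ℝ)))) * M = 1 / 2 := by
    have hνl : 1 * lam = (6 * C₀ * M) ^ 2 := by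
      rw [hlam_def]; field_simp; ring
    have h1 : (1 : ℝ) ^ (-(1 / 2 : ℝ)) * lam ^ (-(1 / 2 : ℝ)) = (6 * C₀ * M)⁻¹ := by
      rw [← Real.mul_rpow zero_le_one hlam.le, hνl, Real.rpow_neg (sq_nonneg _),
        show ((6 * C₀ * M) ^ 2) ^ (1 / 2 : ℝ) = 6 * C₀ * M by
          rw [← Real.sqrt_eq_rpow, Real.sqrt_sq (by positivity)]]
    calc C₀ * ((1 : ℝ) ^ (-(1 / 2 : ℝ)) * (3 * lam ^ (-(1 / 2 : ℝ)))) * M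
        = 3 * C₀ * M * ((1 : ℝ) ^ (-(1 / 2 : ℝ)) * lam ^ (-(1 / 2 : ℝ))) := by ring
      _ = 3 * C₀ * M * (6 * C₀ * M)⁻¹ := by rw [h1]
      _ = 1 / 2 := by field_simp; ring
  -- the kernel decay (3.8) and the tail of its envelope
  obtain ⟨C, hC, hK⟩ := exists_norm_oseenKernel_le (E := EuclideanSpace ℝ (Fin 3))
  set H : EuclideanSpace ℝ (Fin 3) → ℝ := fun z =>
    (2 : ℝ) ^ (((Module.finrank ℝ (EuclideanSpace ℝ (Fin 3)) : ℝ) + 1) / 2) *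
      (1 + ‖z‖ ^ 2) ^ (-((((Module.finrank ℝ (EuclideanSpace ℝ (Fin 3)) : ℝ) + 1) / 2))) with hH
  have hHi : Integrable H volume :=
    (integrable_one_add_norm_sq_rpow_neg (E := EuclideanSpace ℝ (Fin 3))
      (e := (((Module.finrank ℝ (EuclideanSpace ℝ (Fin 3)) : ℝ) + 1) / 2)) (by linarith)).const_mul _
  have htail := tendsto_setIntegral_norm_ge_atTop hHi
  -- slab bounds on the open slab
  have hbdo : ∀ τ ∈ Ioo 0 T, ∀ y, ‖v τ y‖ ≤ M := fun τ hτ => hbd τ ⟨hτ.1.le, hτ.2.le⟩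
  have h0I : (0 : ℝ) ∈ Icc 0 T := ⟨le_rfl, hT.le⟩
  -- ### the weighted far-field supremum `Θ(R)`
  set Θ : ℝ → ℝ := fun R => sSup (insert 0 {r | ∃ τ ∈ Icc 0 T, ∃ y : EuclideanSpace ℝ (Fin 3),
    R < ‖y‖ ∧ r = Real.exp (-(lam * τ)) * ‖v τ y‖}) with hΘ_def
  have hexp1 : ∀ τ ∈ Icc 0 T, Real.exp (-(lam * τ)) ≤ 1 := fun τ hτ => by
    rw [Real.exp_le_one_iff]; nlinarith [hτ.1]
  have hΘbdd : ∀ R, BddAbove (insert 0 {r | ∃ τ ∈ Icc 0 T, ∃ y : EuclideanSpace ℝ (Fin 3),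
      R < ‖y‖ ∧ r = Real.exp (-(lam * τ)) * ‖v τ y‖}) := by
    intro R
    refine ⟨M, ?_⟩
    rintro r (rfl | ⟨τ, hτ, y, -, rfl⟩)
    · exact hM.le
    · calc Real.exp (-(lam * τ)) * ‖v τ y‖ ≤ 1 * M :=
            mul_le_mul (hexp1 τ hτ) (hbd τ hτ y) (norm_nonneg _) zero_le_one
        _ = M := one_mul _
  have hΘne : ∀ R, (insert 0 {r | ∃ τ ∈ Icc 0 T, ∃ y : EuclideanSpace ℝ (Fin 3),
      R < ‖y‖ ∧ r = Real.exp (-(lam * τ)) * ‖v τ y‖}).Nonempty := fun R => ⟨0, mem_insert _ _⟩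
  have hΘ0 : ∀ R, 0 ≤ Θ R := fun R => le_csSup (hΘbdd R) (mem_insert _ _)
  have hΘle : ∀ R c, 0 ≤ c →
      (∀ τ ∈ Icc 0 T, ∀ y, R < ‖y‖ → Real.exp (-(lam * τ)) * ‖v τ y‖ ≤ c) → Θ R ≤ c := by
    intro R c hc h
    refine csSup_le (hΘne R) ?_
    rintro r (rfl | ⟨τ, hτ, y, hy, rfl⟩)
    · exact hc
    · exact h τ hτ y hy
  have hΘM : ∀ R, Θ R ≤ M := fun R => hΘle R M hM.le fun τ hτ y _ => by
    calc Real.exp (-(lam * τ)) * ‖v τ y‖ ≤ 1 * M :=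
          mul_le_mul (hexp1 τ hτ) (hbd τ hτ y) (norm_nonneg _) zero_le_one
      _ = M := one_mul _
  have hΘw : ∀ R, ∀ τ ∈ Icc 0 T, ∀ y, R < ‖y‖ → ‖v τ y‖ ≤ Θ R * Real.exp (lam * τ) := by
    intro R τ hτ y hy
    have hmem : Real.exp (-(lam * τ)) * ‖v τ y‖ ∈ insert (0 : ℝ) {r | ∃ τ ∈ Icc 0 T,
        ∃ y : EuclideanSpace ℝ (Fin 3), R < ‖y‖ ∧ r = Real.exp (-(lam * τ)) * ‖v τ y‖} :=
      mem_insert_of_mem _ ⟨τ, hτ, y, hy, rfl⟩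
    have h1 : Real.exp (-(lam * τ)) * ‖v τ y‖ ≤ Θ R := le_csSup (hΘbdd R) hmem
    have h2 := mul_le_mul_of_nonneg_right h1 (Real.exp_pos (lam * τ)).le
    rwa [mul_assoc, mul_comm ‖v τ y‖, ← mul_assoc, ← Real.exp_add, neg_add_cancel, Real.exp_zero,
      one_mul] at h2
  -- ### the induction: `Θ(A) ≤ M 2^{-n} + θ` for suitable `A`
  have induct : ∀ n : ℕ, ∀ θ : ℝ, 0 < θ → ∃ A : ℝ, Θ A ≤ M / 2 ^ n + θ := by
    intro n
    induction n with
    | zero =>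
      intro θ hθ
      refine ⟨0, ?_⟩
      rw [pow_zero, div_one]
      linarith [hΘM 0]
    | succ n ih =>
      intro θ hθ
      obtain ⟨A₀, hA₀⟩ := ih (θ / 2) (half_pos hθ)
      have hθ8 : 0 < θ / 8 := by positivity
      -- datum, remainder and heat thresholds
      obtain ⟨R₁, hR₁⟩ := hdec0 (θ / 8) hθ8
      obtain ⟨R₂, hR₂⟩ := hdecΦ (θ / 8) hθ8
      obtain ⟨R₃, hR₃⟩ := exists_forall_norm_heatFlow_le_of_norm (g := v 0) (hbd 0 h0I) hdec0 T hθ8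
      -- the splitting radius and the kernel-tail threshold
      set R₀ : ℝ := max A₀ 0 + 1 with hR₀_def
      have hA₀R₀ : A₀ < R₀ := by
        have := le_max_left A₀ 0; rw [hR₀_def]; linarith
      set η₁ : ℝ := θ / 8 / (C * (M * M) * T + 1) with hη₁
      have hCMT : 0 < C * (M * M) * T + 1 := by positivity
      have hη₁0 : 0 < η₁ := by positivity
      obtain ⟨R₄, hR₄⟩ := ((htail.eventually (Iio_mem_nhds hη₁0)).and
        (eventually_ge_atTop 1)).exists
      obtain ⟨hR₄i, hR₄1⟩ := hR₄
      have hR₄i' : ∫ z in {z : EuclideanSpace ℝ (Fin 3) | R₄ ≤ ‖z‖}, H z ≤ η₁ := le_of_lt hR₄i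
      -- the new threshold
      set A : ℝ := max (max (max R₁ R₂) R₃) (R₀ + 1 + R₄) with hA_def
      have hAR₁ : R₁ ≤ A := le_trans (le_trans (le_max_left _ _) (le_max_left _ _)) (le_max_left _ _)
      have hAR₂ : R₂ ≤ A := le_trans (le_trans (le_max_right _ _) (le_max_left _ _)) (le_max_left _ _)
      have hAR₃ : R₃ ≤ A := le_trans (le_max_right _ _) (le_max_left _ _)
      have hAR₄ : R₀ + 1 + R₄ ≤ A := le_max_right _ _
      refine ⟨A, hΘle A _ (by positivity) ?_⟩
      intro τ hτ x hx
      rcases hτ.1.eq_or_lt with h0 | hτ0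
      · -- `τ = 0`: the datum
        rw [← h0, mul_zero, neg_zero, Real.exp_zero, one_mul]
        have h1 := hR₁ x (hAR₁.trans hx.le)
        have h2 : 0 ≤ M / 2 ^ (n + 1) := by positivity
        linarith
      have hτI : τ ∈ Ioc 0 T := ⟨hτ0, hτ.2⟩
      -- the near and far pieces of the right factor
      set vnear : ℝ → EuclideanSpace ℝ (Fin 3) → EuclideanSpace ℝ (Fin 3) :=
        fun σ y => if ‖y‖ ≤ R₀ then v σ y else 0 with hvnear_def
      set vfar : ℝ → EuclideanSpace ℝ (Fin 3) → EuclideanSpace ℝ (Fin 3) :=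
        fun σ y => v σ y - vnear σ y with hvfar_def
      have hSm : MeasurableSet {p : ℝ × EuclideanSpace ℝ (Fin 3) | ‖p.2‖ ≤ R₀} :=
        (isClosed_le (continuous_norm.comp continuous_snd) continuous_const).measurableSet
      have hvnear_eq : uncurry vnear =
          {p : ℝ × EuclideanSpace ℝ (Fin 3) | ‖p.2‖ ≤ R₀}.indicator (uncurry v) := by
        funext p
        rcases p with ⟨σ, y⟩
        by_cases hy : ‖y‖ ≤ R₀
        · simp [hvnear_def, uncurry, hy]
        · simp [hvnear_def, uncurry, hy]
      have hmeas_near : AEStronglyMeasurable (uncurry vnear)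
          ((volume : Measure (ℝ × EuclideanSpace ℝ (Fin 3))).restrict (Ioo 0 T ×ˢ univ)) := by
        rw [hvnear_eq]; exact hmeas.indicator hSm
      have hnear_bd : ∀ σ y, ‖vnear σ y‖ ≤ ‖v σ y‖ := by
        intro σ y
        by_cases hy : ‖y‖ ≤ R₀
        · simp [hvnear_def, hy]
        · simp [hvnear_def, hy]
      have hnear_M : ∀ σ ∈ Ioo 0 T, ∀ y, ‖vnear σ y‖ ≤ M := fun σ hσ y =>
        (hnear_bd σ y).trans (hbdo σ hσ y)
      have hfar_w : ∀ σ ∈ Icc 0 T, ∀ y, ‖vfar σ y‖ ≤ Θ A₀ * Real.exp (lam * σ) := by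
        intro σ hσ y
        by_cases hy : ‖y‖ ≤ R₀
        · have : vfar σ y = 0 := by simp [hvfar_def, hvnear_def, hy]
          rw [this, norm_zero]
          exact mul_nonneg (hΘ0 A₀) (Real.exp_pos _).le
        · have : vfar σ y = v σ y := by simp [hvfar_def, hvnear_def, hy]
          rw [this]
          exact hΘw A₀ σ hσ y (hA₀R₀.trans (not_le.1 hy))
      have hsupp : ∀ σ ∈ Ioo 0 τ, ∀ y, R₀ + 1 ≤ ‖y‖ → ‖v σ y‖ * ‖vnear σ y‖ = 0 := by
        intro σ _ y hy
        have hy' : ¬ ‖y‖ ≤ R₀ := by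
          intro h; linarith
        have : vnear σ y = 0 := by simp [hvnear_def, hy']
        rw [this, norm_zero, mul_zero]
      -- the splitting `B(v,v) = B(v,vnear) + B(v,vfar)`
      have hsplit : ∀ y, oseenDuhamel 1 0 v v τ y =
          oseenDuhamel 1 0 v vnear τ y + oseenDuhamel 1 0 v vfar τ y := by
        intro y
        have h := oseenDuhamel_sub_right hν hmeas hmeas hmeas_near hbdo hbdo hnear_M hτ0 hτ.2 y
        change oseenDuhamel 1 0 v vfar τ y = _ at h
        rw [h]; abel
      -- the near piece, far away (kernel decay)
      have hnear : ‖oseenDuhamel 1 0 v vnear τ x‖ ≤ θ / 8 := by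
        have hx' : R₀ + 1 + R₄ ≤ ‖x‖ := hAR₄.trans hx.le
        have h := norm_oseenDuhamel_near_le_of_norm hC hK (v := v) (w := vnear) (s := 0) (t := τ)
          hτ0 hM.le hM.le (fun σ hσ => hbdo σ ⟨hσ.1, hσ.2.trans_le hτ.2⟩)
          (fun σ hσ => hnear_M σ ⟨hσ.1, hσ.2.trans_le hτ.2⟩) hsupp hR₄1 hx'
        refine h.trans ?_
        have hint0 : 0 ≤ ∫ z in {z : EuclideanSpace ℝ (Fin 3) | R₄ ≤ ‖z‖}, H z :=
          setIntegral_nonneg (isClosed_le continuous_const continuous_norm).measurableSet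
            fun z _ => by positivity
        calc C * (M * M) * (τ - 0) * ∫ z in {z : EuclideanSpace ℝ (Fin 3) | R₄ ≤ ‖z‖}, H z
            ≤ C * (M * M) * T * η₁ := by
              rw [sub_zero]
              exact mul_le_mul (mul_le_mul_of_nonneg_left hτ.2 (by positivity)) hR₄i' hint0
                (by positivity)
          _ ≤ (C * (M * M) * T + 1) * η₁ := by gcongr; linarith
          _ = θ / 8 := by rw [hη₁]; field_simp
      -- the far piece (slice estimate against the exponential weight)
      have hfar : ‖oseenDuhamel 1 0 v vfar τ x‖ ≤ 1 / 2 * (Θ A₀ * Real.exp (lam * τ)) := by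
        obtain ⟨hIw, hIle⟩ :=
          setIntegral_visc_abelKernel_mul_exp_le (K := Θ A₀) hν hlam hτ.1 (hΘ0 A₀)
        have hint : IntegrableOn
            (fun σ => (1 * (τ - σ)) ^ (-(1 / 2 : ℝ)) * (M * (Θ A₀ * Real.exp (lam * σ)))) (Ioo 0 τ) := by
          have := hIw.const_mul M
          exact IntegrableOn.congr_fun this (fun σ _ => by ring) measurableSet_Ioo
        refine (norm_oseenDuhamel_le_setIntegral_visc hν
          (fun σ hσ => hbdo σ ⟨hσ.1, hσ.2.trans_le hτ.2⟩)
          (fun σ hσ => hfar_w σ ⟨hσ.1.le, hσ.2.le.trans hτ.2⟩) hint x).trans ?_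
        have heq : ∫ σ in Ioo 0 τ, (1 * (τ - σ)) ^ (-(1 / 2 : ℝ)) * (M * (Θ A₀ * Real.exp (lam * σ))) =
            M * ∫ σ in Ioo 0 τ, (1 * (τ - σ)) ^ (-(1 / 2 : ℝ)) * (Θ A₀ * Real.exp (lam * σ)) := by
          rw [← integral_const_mul]
          refine setIntegral_congr_fun measurableSet_Ioo fun σ _ => by ring
        rw [heq]
        calc oseenSliceConst (EuclideanSpace ℝ (Fin 3)) *
              (M * ∫ σ in Ioo 0 τ, (1 * (τ - σ)) ^ (-(1 / 2 : ℝ)) * (Θ A₀ * Real.exp (lam * σ)))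
            ≤ C₀ * (M * (Θ A₀ * (1 : ℝ) ^ (-(1 / 2 : ℝ)) *
                (3 * lam ^ (-(1 / 2 : ℝ)) * Real.exp (lam * τ)))) := by
              rw [← hC₀def]
              exact mul_le_mul_of_nonneg_left (mul_le_mul_of_nonneg_left hIle hM.le) hC₀.le
          _ = (C₀ * ((1 : ℝ) ^ (-(1 / 2 : ℝ)) * (3 * lam ^ (-(1 / 2 : ℝ)))) * M) *
                (Θ A₀ * Real.exp (lam * τ)) := by ring
          _ = 1 / 2 * (Θ A₀ * Real.exp (lam * τ)) := by rw [hkey]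
      -- the heat term and the remainder, far away
      have hheat : ‖UnboundedOperators.heatExtension (v 0) τ x‖ ≤ θ / 8 := by
        have h := hR₃ τ hτ x (hAR₃.trans hx.le)
        rwa [heatFlow_of_pos _ hτ0] at h
      have hΦ : ‖Φ τ x‖ ≤ θ / 8 := hR₂ τ hτI x (hAR₂.trans hx.le)
      -- the pointwise bound on the open far region, from the a.e. identity
      have hU : IsOpen {y : EuclideanSpace ℝ (Fin 3) | A < ‖y‖} := isOpen_lt continuous_const continuous_norm
      have hae : ∀ᵐ y ∂(volume : Measure (EuclideanSpace ℝ (Fin 3))),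
          y ∈ {y : EuclideanSpace ℝ (Fin 3) | A < ‖y‖} →
            ‖v τ y‖ ≤ 3 * (θ / 8) + 1 / 2 * (Θ A₀ * Real.exp (lam * τ)) := by
        filter_upwards [hrep τ hτI] with y hy hyA
        have hyA' : A < ‖y‖ := hyA
        -- the four bounds at `y`
        have hheat_y : ‖UnboundedOperators.heatExtension (v 0) τ y‖ ≤ θ / 8 := by
          have h := hR₃ τ hτ y (hAR₃.trans hyA'.le)
          rwa [heatFlow_of_pos _ hτ0] at h
        have hΦ_y : ‖Φ τ y‖ ≤ θ / 8 := hR₂ τ hτI y (hAR₂.trans hyA'.le)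
        have hnear_y : ‖oseenDuhamel 1 0 v vnear τ y‖ ≤ θ / 8 := by
          have hy' : R₀ + 1 + R₄ ≤ ‖y‖ := hAR₄.trans hyA'.le
          have h := norm_oseenDuhamel_near_le_of_norm hC hK (v := v) (w := vnear) (s := 0) (t := τ)
            hτ0 hM.le hM.le (fun σ hσ => hbdo σ ⟨hσ.1, hσ.2.trans_le hτ.2⟩)
            (fun σ hσ => hnear_M σ ⟨hσ.1, hσ.2.trans_le hτ.2⟩) hsupp hR₄1 hy'
          refine h.trans ?_
          have hint0 : 0 ≤ ∫ z in {z : EuclideanSpace ℝ (Fin 3) | R₄ ≤ ‖z‖}, H z :=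
            setIntegral_nonneg (isClosed_le continuous_const continuous_norm).measurableSet
              fun z _ => by positivity
          calc C * (M * M) * (τ - 0) * ∫ z in {z : EuclideanSpace ℝ (Fin 3) | R₄ ≤ ‖z‖}, H z
              ≤ C * (M * M) * T * η₁ := by
                rw [sub_zero]
                exact mul_le_mul (mul_le_mul_of_nonneg_left hτ.2 (by positivity)) hR₄i' hint0
                  (by positivity)
            _ ≤ (C * (M * M) * T + 1) * η₁ := by gcongr; linarith
            _ = θ / 8 := by rw [hη₁]; field_simp
        have hfar_y : ‖oseenDuhamel 1 0 v vfar τ y‖ ≤ 1 / 2 * (Θ A₀ * Real.exp (lam * τ)) := by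
          obtain ⟨hIw, hIle⟩ :=
            setIntegral_visc_abelKernel_mul_exp_le (K := Θ A₀) hν hlam hτ.1 (hΘ0 A₀)
          have hint : IntegrableOn
              (fun σ => (1 * (τ - σ)) ^ (-(1 / 2 : ℝ)) * (M * (Θ A₀ * Real.exp (lam * σ)))) (Ioo 0 τ) := by
            have := hIw.const_mul M
            exact IntegrableOn.congr_fun this (fun σ _ => by ring) measurableSet_Ioo
          refine (norm_oseenDuhamel_le_setIntegral_visc hν
            (fun σ hσ => hbdo σ ⟨hσ.1, hσ.2.trans_le hτ.2⟩)
            (fun σ hσ => hfar_w σ ⟨hσ.1.le, hσ.2.le.trans hτ.2⟩) hint y).trans ?_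
          have heq : ∫ σ in Ioo 0 τ, (1 * (τ - σ)) ^ (-(1 / 2 : ℝ)) * (M * (Θ A₀ * Real.exp (lam * σ))) =
              M * ∫ σ in Ioo 0 τ, (1 * (τ - σ)) ^ (-(1 / 2 : ℝ)) * (Θ A₀ * Real.exp (lam * σ)) := by
            rw [← integral_const_mul]
            refine setIntegral_congr_fun measurableSet_Ioo fun σ _ => by ring
          rw [heq]
          calc oseenSliceConst (EuclideanSpace ℝ (Fin 3)) *
                (M * ∫ σ in Ioo 0 τ, (1 * (τ - σ)) ^ (-(1 / 2 : ℝ)) * (Θ A₀ * Real.exp (lam * σ)))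
              ≤ C₀ * (M * (Θ A₀ * (1 : ℝ) ^ (-(1 / 2 : ℝ)) *
                  (3 * lam ^ (-(1 / 2 : ℝ)) * Real.exp (lam * τ)))) := by
                rw [← hC₀def]
                exact mul_le_mul_of_nonneg_left (mul_le_mul_of_nonneg_left hIle hM.le) hC₀.le
            _ = (C₀ * ((1 : ℝ) ^ (-(1 / 2 : ℝ)) * (3 * lam ^ (-(1 / 2 : ℝ)))) * M) *
                  (Θ A₀ * Real.exp (lam * τ)) := by ring
            _ = 1 / 2 * (Θ A₀ * Real.exp (lam * τ)) := by rw [hkey]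
        rw [hy, hsplit y]
        calc ‖UnboundedOperators.heatExtension (v 0) τ y -
              (oseenDuhamel 1 0 v vnear τ y + oseenDuhamel 1 0 v vfar τ y) + Φ τ y‖
            ≤ ‖UnboundedOperators.heatExtension (v 0) τ y -
              (oseenDuhamel 1 0 v vnear τ y + oseenDuhamel 1 0 v vfar τ y)‖ + ‖Φ τ y‖ :=
              norm_add_le _ _
          _ ≤ (‖UnboundedOperators.heatExtension (v 0) τ y‖ +
              ‖oseenDuhamel 1 0 v vnear τ y + oseenDuhamel 1 0 v vfar τ y‖) + ‖Φ τ y‖ := by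
              gcongr; exact norm_sub_le _ _
          _ ≤ (θ / 8 + (θ / 8 + 1 / 2 * (Θ A₀ * Real.exp (lam * τ)))) + θ / 8 :=
              add_le_add (add_le_add hheat_y
                ((norm_add_le _ _).trans (add_le_add hnear_y hfar_y))) hΦ_y
          _ = 3 * (θ / 8) + 1 / 2 * (Θ A₀ * Real.exp (lam * τ)) := by ring
      have hpt := forall_norm_le_of_ae_norm_le_on (hslc τ hτ) hU hae x hx
      -- multiply by the weight
      have hexp : 0 < Real.exp (-(lam * τ)) := Real.exp_pos _
      have hw1 := hexp1 τ hτ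
      have hcancel : Real.exp (-(lam * τ)) * Real.exp (lam * τ) = 1 := by
        rw [← Real.exp_add, neg_add_cancel, Real.exp_zero]
      have h2n : M / 2 ^ (n + 1) = 1 / 2 * (M / 2 ^ n) := by
        rw [pow_succ]; field_simp
      calc Real.exp (-(lam * τ)) * ‖v τ x‖
          ≤ Real.exp (-(lam * τ)) * (3 * (θ / 8) + 1 / 2 * (Θ A₀ * Real.exp (lam * τ))) :=
            mul_le_mul_of_nonneg_left hpt hexp.le
        _ = Real.exp (-(lam * τ)) * (3 * (θ / 8)) +
              1 / 2 * Θ A₀ * (Real.exp (-(lam * τ)) * Real.exp (lam * τ)) := by ring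
        _ = Real.exp (-(lam * τ)) * (3 * (θ / 8)) + 1 / 2 * Θ A₀ := by rw [hcancel, mul_one]
        _ ≤ 1 * (3 * (θ / 8)) + 1 / 2 * (M / 2 ^ n + θ / 2) := by
            gcongr
        _ = M / 2 ^ (n + 1) + (5 * θ / 8) := by rw [h2n]; ring
        _ ≤ M / 2 ^ (n + 1) + θ := by linarith
  -- ### conclusion
  set θ : ℝ := ε * Real.exp (-(lam * T)) / 2 with hθ_def
  have hθ : 0 < θ := by positivity
  obtain ⟨n, hn⟩ := pow_unbounded_of_one_lt (M / θ) (by norm_num : (1 : ℝ) < 2)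
  have hMn : M / 2 ^ n ≤ θ := by
    rw [div_le_iff₀ (by positivity)]
    rw [div_lt_iff₀ hθ] at hn
    linarith
  obtain ⟨A, hA⟩ := induct n θ hθ
  refine ⟨A + 1, fun t ht x hx => ?_⟩
  have hxA : A < ‖x‖ := by linarith
  have h1 := hΘw A t ht x hxA
  have hΘA : Θ A ≤ 2 * θ := by linarith
  have hexpT : Real.exp (lam * t) ≤ Real.exp (lam * T) :=
    Real.exp_le_exp.2 (mul_le_mul_of_nonneg_left ht.2 hlam.le)
  calc ‖v t x‖ ≤ Θ A * Real.exp (lam * t) := h1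
    _ ≤ 2 * θ * Real.exp (lam * T) :=
        mul_le_mul hΘA hexpT (Real.exp_pos _).le (by positivity)
    _ = ε * (Real.exp (-(lam * T)) * Real.exp (lam * T)) := by rw [hθ_def]; ring
    _ = ε := by rw [← Real.exp_add, neg_add_cancel, Real.exp_zero, mul_one]

/-- **A bounded classical finite-energy solution of the unforced Navier–Stokes system (`ν = 1`) on
`[0, T] × ℝ³` whose datum vanishes at infinity vanishes at spatial infinity uniformly on `[0, T]`.**
(The datum condition holds e.g. for compactly supported or Schwartz data.) The mild identity is the
tree's `IsClassicalNSSolutionOn.ae_eq_forced_oseenMild` with the zero force.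
[cite: KochNadirashviliSereginSverak2009, proof of Thm 6.1, last paragraph (arXiv p. 12)] -/
theorem IsClassicalNSSolutionOn.exists_forall_norm_le_of_datum_decay
    {q : ℝ → EuclideanSpace ℝ (Fin 3) → ℝ}
    (hcl : IsClassicalNSSolutionOn (Icc 0 T) 1 0 v q) (hT : 0 < T)
    (hE : ∃ C : ℝ≥0∞, C < ⊤ ∧ ∀ t ∈ Icc 0 T, ∫⁻ x, ‖v t x‖ₑ ^ 2 ≤ C)
    (hM : 0 < M) (hbd : ∀ t ∈ Icc 0 T, ∀ y, ‖v t y‖ ≤ M)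
    (hdec0 : ∀ η : ℝ, 0 < η → ∃ R : ℝ, ∀ y, R ≤ ‖y‖ → ‖v 0 y‖ ≤ η)
    {ε : ℝ} (hε : 0 < ε) :
    ∃ A : ℝ, ∀ t ∈ Icc 0 T, ∀ x, A ≤ ‖x‖ → ‖v t x‖ ≤ ε := by
  have hslc : ∀ t ∈ Icc 0 T, Continuous (v t) := fun t ht => (hcl.contDiff_velocity ht).continuous
  have hmeas : AEStronglyMeasurable (uncurry v)
      ((volume : Measure (ℝ × EuclideanSpace ℝ (Fin 3))).restrict (Ioo 0 T ×ˢ univ)) :=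
    (hcl.smooth_velocity.continuousOn.mono (prod_mono Ioo_subset_Icc_self Subset.rfl)).aestronglyMeasurable
      (measurableSet_Ioo.prod MeasurableSet.univ)
  have hgc : Continuous (uncurry (0 : ℝ → EuclideanSpace ℝ (Fin 3) → EuclideanSpace ℝ (Fin 3))) :=
    continuous_const
  have hG : ∀ τ ∈ Icc 0 T, ∀ y,
      ‖(0 : ℝ → EuclideanSpace ℝ (Fin 3) → EuclideanSpace ℝ (Fin 3)) τ y‖ ≤ 0 := fun τ _ y => by simp
  have hgdiv : ∀ τ ∈ Icc 0 T,
      IsWeaklyDivFree ((0 : ℝ → EuclideanSpace ℝ (Fin 3) → EuclideanSpace ℝ (Fin 3)) τ) :=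
    fun τ _ θ _ => by simp
  have hg2 : ∀ τ ∈ Icc 0 T,
      eLpNorm ((0 : ℝ → EuclideanSpace ℝ (Fin 3) → EuclideanSpace ℝ (Fin 3)) τ) 2 volume ≤ (0 : ℝ≥0∞) :=
    fun τ _ => by simp
  have h0 : ∀ t (x : EuclideanSpace ℝ (Fin 3)),
      forceDuhamel 1 0 (0 : ℝ → EuclideanSpace ℝ (Fin 3) → EuclideanSpace ℝ (Fin 3)) t x = 0 := by
    intro t x
    rw [forceDuhamel_apply]
    have hz : ∀ τ, UnboundedOperators.heatExtension
        ((0 : ℝ → EuclideanSpace ℝ (Fin 3) → EuclideanSpace ℝ (Fin 3)) τ) (1 * (t - τ)) x = 0 := by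
      intro τ
      have : ((0 : ℝ → EuclideanSpace ℝ (Fin 3) → EuclideanSpace ℝ (Fin 3)) τ) =
          fun _ : EuclideanSpace ℝ (Fin 3) => (0 : EuclideanSpace ℝ (Fin 3)) := rfl
      rw [this, UnboundedOperators.heatExtension_zero_fun]; rfl
    simp_rw [hz, integral_zero]
  have hrep : ∀ t ∈ Ioc 0 T, v t =ᵐ[volume] fun x =>
      UnboundedOperators.heatExtension (v 0) t x - oseenDuhamel 1 0 v v t x +
        (0 : ℝ → EuclideanSpace ℝ (Fin 3) → EuclideanSpace ℝ (Fin 3)) t x := by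
    intro t ht
    have h := hcl.ae_eq_forced_oseenMild one_pos hT hgc hG hgdiv ENNReal.zero_ne_top hg2 hE hM hbd ht
    filter_upwards [h] with x hx
    rw [hx, h0 t x, one_mul]
    simp
  exact exists_forall_norm_le_of_oseenMild_remainder hT hslc hmeas hM hbd hrep hdec0
    (fun η hη => ⟨0, fun t _ x _ => by simpa using hη.le⟩) hε

end Decay

end Literature.Analysis.FluidPDE

end
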